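import Literature.MathematicalPhysics.QuantumFieldTheory.Balaban1983to89.B9Eq342GreenPrimeSupBound
import Literature.MathematicalPhysics.QuantumFieldTheory.Balaban1983to89.B9Eq324DeltaPrimeATower

/-!
# `Balaban1983to89.B9Eq342GreenPrimeTowerSupBound` — T. Bałaban, *Propagators for lattice gauge theories in a background field*, Commun. Math. Phys. **99** (1985)
# 389–434 [Balaban1985BackgroundPropagators] Thm 3.1 (3.42) p. 397, FIRST ENTRY, AT THE TOP LEVEL, FOR PRINT's `G′_k(U) = (Δ′_{a′,k}(U))⁻¹` AT `k = n+1` AVERAGING LEVELS of (3.24)–(3.25)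
# p. 394 (`B9Eq324DeltaPrimeATower.GpOfUk`, NAMED — the k-LEVEL twin of `B9Eq342GreenPrimeSupBound`, where «level-free» is read): **`‖(G′(U)f)(x)‖ ≤ B₀·|f|` with `B₀ = 2 + (2p₂ + C₃)·C_E·√μ` CLOSED-FORM IN FOUR DISPLAYED LETTERS — the
# `L² → L^∞` size `p₂` of the averaging penalty `a′Q′(U)†Q′(U)`, the energy bound `C_E` of `G′(U)`, the flat scalar letter `C₃` (`‖(Δ^η + 1)⁻²‖_{L²→L^∞}`)
# and the `L²`-mass `√μ` of the support of `f` — for EVERY background whose transporters `R(U(b))`, `R(U(b)⁻¹)` contract the fibre; Kato domination used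
# twice (`B9Eq342SupNormBootstrap.norm_le_of_kato_bootstrap_energy`) at the chain's covariant Laplacian (3.23) (`B9Eq323KatoDomination` §3)** — stone (I) of the
# NE9 owner's SUP-NORM PROGRAMME (plan v10): the VALUE row of Theorem 3.1 for the chain's site propagator, modulo letters each of which is level-free on
# the diagonal class

statement-level skeleton of published theorems with citation tags; proofs where landed; nothing here is a claim about the Yang–Mills mass gap

CITATION HEADER (lean-in-tree rule).  Audit cell `pub-balaban`, sub-cell `t4`, BINDER row NE9; filed by the row OWNER lineage `b2b-balaban-t4-ne9-p1` (gen 89, plan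
v10 `g89/SUP-NORM-PROGRAMME.md` §3).  Source READ first-hand in the held text layer [Balaban1985BackgroundPropagators] (`paper:balaban1985-cmp99-background-propagators`,
journal page = PDF page + 388): p. 394 (3.23) *«Δ^η_U = D*_U D_U»*, (3.24) *«Δ′_a(U) = Δ^η_U + Q′*(U)aQ′(U)»*, (3.25) *«G′ = G′(U) = (Δ′_a)⁻¹»*; p. 397 (3.39) *«Thus
we have the supremum norms |λ| = max sup|λ_μ(x)|»*, Thm 3.1 *«There exist positive constants M₁, δ₀, a₀, B₀ dependent on d and L only … such that for M ≥ M₁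
and for an arbitrary configuration U satisfying the regularity condition (3.35) with Mα₀ ≤ a₀, the operator G′(U) (a = 1) satisfies the inequalities
|(G′(U)λ)(x)|, … ≤ B₀ … for x ∈ Δ(y), y ∈ Λ_j, supp λ ⊂ Δ(y′) (3.42)»*; p. 398 *«All these inequalities are invariant with respect to gauge transformations
of U. … We will prove the above theorem by constructing a random walk representation»* — NOTHING of that proof is reproduced; the cell's substitute is the
positivity route of `B9Eq323KatoDomination` ([DodziukMathai2006] §1 by name) + `B9Eq342SupNormBootstrap`.

WHY THIS FILE (cell context; DIAGNOSIS D-ne9p1-g89-1).  The (N)-reading of row NE9 needs the chain's k-level letters in sup-norm currency with level-free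
constants; the chain holds them in the energy currency.  This file closes the first sup-norm row for print's site propagator `G′(U)` — the input of everything
else in [B9] Sect. 3 (`R(U)`, `G(U)`, `𝔊`) — with the analytic content reduced to FOUR letters, each separately inhabited or inhabitable level-free on the
diagonal: `C_E = 4∕γ` (`B9Eq349ConjugatedGreenLetters.norm_Gk_le`), `C₃` (spectral form `B5Eq129FreeResolventSupBoundSites.le_of_double_resolvent_weighted_tsite_sumElim`;
level-free bound `√(3^d∕c₁)` = (FS-b), gan24-leaf-01's `ScalarFreeResolventDiagonal` method), `p₂` (one Cauchy–Schwarz on a unit block), `√μ = √c₁` (one block).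

WHAT IS PROVED (sorry-free; 0 `def`; [folklore] composition BY NAME).  Data: the chain's tower torus `TSite d (towerP L m (n+1))` (`k = n+1` averaging levels, composite averaging `Q̃′_k(U)` inside `laplacePrimeAk`), fibre `W ≃ 𝔸` (`φ`), weight `c₀`,
background `U`, scalars `η`, `a′`, the positivity witness `hpos′` of `Δ′_{a′}(U)` (as everywhere in the chain), and:
(T) CONTRACTION `‖R(U(b))w‖ ≤ ‖w‖`, `‖R(U(b)⁻¹)w‖ ≤ ‖w‖` on the fibre (`adTransportW φ U`, `adTransportW φ U⁻¹`) — unitary `U` on an Ad-invariant fibre norm;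
(P) PENALTY `‖((Δ′_{a′}(U) − Δ^η_U)v)(x)‖ = ‖(a′Q′†Q′v)(x)‖ ≤ p₂·‖v‖_{L²}` (stated as the difference `laplacePrimeA − covLaplaceSiteK`); (E) ENERGY `‖G′(U)g‖ ≤ C_E‖g‖`; (FS) the flat scalar letter on `TSite d (L·m)` in the `Sum.elim unshift shift` shape with
weight `η⁻²`, mass `1`, constant `C₃`; (supp) `‖f‖_{L²} ≤ √μ·F`, `‖f(y)‖ ≤ F`.
* `norm_eq_sqrt_sum_tower` — bookkeeping `‖v‖_{L²(c₀)} = √(Σ_y c₀‖v(y)‖²)` on the tower carrier.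
* **`norm_GpOfUk_apply_le`** — `‖(G′_k(U)f)(x)‖ ≤ (2 + (2p₂ + C₃)·C_E·√μ)·F` at every site of `T_{L^{n+1}m}`, for EVERY `n`; **`norm_GpOfUk_apply_le_unitary`** —
  the same with (T) supplied by `B9Eq342GreenPrimeSupBound.norm_adTransportW_eq∕_inv_eq` from the chain's standing letters `hU`, `hτ₂`, `hφ`.
HONEST SCOPE.  Composition; the four letters are HYPOTHESES (inhabited elsewhere ∕ to be inhabited: (E) on the diagonal window by `norm_Gk_le`; (FS) spectrally by
`B5Eq129FreeResolventSupBoundSites`, level-free by (FS-b); (P) one line for the typist of the class; (T) discharged here); VALUE row only — no decay in `d(y,y′)` (storey (D)), no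
∇-row, no Hölder norms; `B₀` crude.  NOT summit progress (cell pub-balaban: NE9 NOT PRINTED ∕ NOT PROVED; «NE9 ⇐ the named binders»; row WALLED ON A MODEL (O-NE9-1;
#5 UNRULED); spine PROVED 0∕9; rung (B)+1 finite T⁴ — NOT infinite volume, NOT mass gap, NOT BetaPertH, NOT Clay).  HONEST DEPENDENCY (cell line): continuum YM on T⁴ ⇐
BetaPertH ∧ nine spine estimates (0/9 proved); BetaPertH ⇐ (D1) ∧ (D4) ∧ CAP+tail; G-an2-4 gates asym, D1 and NE2/3/4.  NEW file importing `B9Eq342GreenPrimeSupBound` +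
`B9Eq324DeltaPrimeATower`; nothing modified.  Net new unproved facts: 0.
-/

noncomputable section

open scoped InnerProductSpace ComplexConjugate BigOperators

namespace Literature.MathematicalPhysics.QuantumFieldTheory.Balaban1983to89.B9Eq342GreenPrimeTowerSupBound

open B4Sect5Torus (TSite)
open B9SectCLatticeCarrier (Bond shift unshift)
open B9Eq319QprimeTorus (fineP)
open B9Eq311L2Pairing (WL2)
open B11Eq103H1Complex (SiteL2K covLaplaceSiteK apply_greenK)
open B9Eq310HessianOperator (adTransportW adTransportW_apply)
open B9Eq310HessianHermitian (adTransportW_adjoint star_val_inv_of_unitary)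
open B9Eq315QTower (towerP)
open B9Eq324DeltaPrimeATower (laplacePrimeAk GpOfUk)
open B9Eq342GreenPrimeSupBound (adTransportW_inv_adTransportW norm_adTransportW_eq norm_adTransportW_inv_eq)
open B9Eq323KatoDomination (equiv_covLaplaceSiteK_eq_sum)
open B9Eq342SupNormBootstrap (norm_le_of_kato_bootstrap_energy)

/-! ## §1 The value row of (3.42) for `G′_k(U)` at `k = n+1` levels -/

section Instance

variable {d : ℕ} (L : ℕ) [NeZero L] (m : Fin d → ℕ) [∀ i, NeZero (m i)] (n : ℕ)
  {𝔸 : Type*} [NormedRing 𝔸] [NormedAlgebra ℂ 𝔸] [CompleteSpace 𝔸]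
  {W : Type*} [NormedAddCommGroup W] [InnerProductSpace ℂ W] [FiniteDimensional ℂ W] (φ : W ≃ₗ[ℂ] 𝔸) {c₀ : ℝ} [Fact (0 < c₀)]
  (η : ℝ) (U : Bond d (towerP L m (n + 1)) → 𝔸ˣ) {c₁ : ℝ} [Fact (0 < c₁)] (a' : ℝ)
  (hpos' : ∀ x : SiteL2K ℂ d (towerP L m (n + 1)) c₀ W, x ≠ 0 → 0 < RCLike.re ⟪x, laplacePrimeAk L m n φ η U a' (c₁ := c₁) x⟫_ℂ)

omit [NeZero L] [∀ i, NeZero (m i)] [FiniteDimensional ℂ W] in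
/-- Bookkeeping: the weighted `L²` norm (3.11) on the tower carrier IS `√(Σ_y c₀‖v(y)‖²)`. [cite: Balaban1985BackgroundPropagators, (3.11) p.392] -/
theorem norm_eq_sqrt_sum_tower (v : SiteL2K ℂ d (towerP L m (n + 1)) c₀ W) :
    ‖v‖ = Real.sqrt (∑ y, c₀ * ‖WL2.equiv ℂ _ W v y‖ ^ 2) := by
  rw [← WL2.norm_sq, Real.sqrt_sq (norm_nonneg _)]

/-- **THE VALUE ROW OF (3.42) AT `k = n+1` LEVELS FOR PRINT's `G′_k(U)`, `B₀` CLOSED-FORM IN THE LETTERS** (k-level twin of `B9Eq342GreenPrimeSupBound.norm_GpOfU_apply_le`; «level-free» = every letter independent of `n`).  For contractive transporters (T), the penalty letter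
(P) `‖((Δ′_{a′}(U) − Δ^η_U)v)(x)‖ ≤ p₂‖v‖` (the averaging penalty `a′Q′(U)†Q′(U)`), the energy letter (E) `‖G′(U)g‖ ≤ C_E‖g‖`, the flat scalar letter (FS) with constant `C₃` (weight `η⁻²`, mass `1`, `L²`-weight
`c₀`, on `TSite d (L·m)` in the `Sum.elim unshift shift` shape) and data `f` with `‖f(y)‖ ≤ F`, `‖f‖ ≤ √μ·F`:
`‖(G′(U)f)(x)‖ ≤ (2 + (2p₂ + C₃)·C_E·√μ)·F` at every site — print's «|(G′(U)λ)(x)| ≤ B₀|λ|» at `L^jη = 1`, EVERY such background, no window beyond the letters.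
[cite: Balaban1985BackgroundPropagators, Thm 3.1 (3.42) p.397, (3.24)–(3.25) p.394] -/
theorem norm_GpOfUk_apply_le
    (hR : ∀ b w, ‖adTransportW φ U b w‖ ≤ ‖w‖) (hS : ∀ b w, ‖adTransportW φ (fun b => (U b)⁻¹) b w‖ ≤ ‖w‖)
    {p₂ CE C₃ : ℝ} (hp₂ : 0 ≤ p₂) (hCE : 0 ≤ CE) (hC₃ : 0 ≤ C₃)
    (hP : ∀ (v : SiteL2K ℂ d (towerP L m (n + 1)) c₀ W) (x : TSite d (towerP L m (n + 1))),
      ‖WL2.equiv ℂ _ W (laplacePrimeAk L m n φ η U a' (c₁ := c₁) v -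
        covLaplaceSiteK ((η : ℂ))⁻¹ (adTransportW φ U) (adTransportW φ fun b => (U b)⁻¹) v) x‖ ≤ p₂ * ‖v‖)
    (hE : ∀ g, ‖GpOfUk L m n φ η U a' hpos' g‖ ≤ CE * ‖g‖)
    (hFS : ∀ ψ φ₁ φ₂ : TSite d (towerP L m (n + 1)) → ℝ, (∀ x, 0 ≤ ψ x) →
      (∀ x, ∑ j : Fin d ⊕ Fin d, (η⁻¹) ^ 2 * (φ₁ x - φ₁ (Sum.elim (fun μ => unshift μ x) (fun μ => shift μ x) j)) + 1 * φ₁ x = ψ x) →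
      (∀ x, ∑ j : Fin d ⊕ Fin d, (η⁻¹) ^ 2 * (φ₂ x - φ₂ (Sum.elim (fun μ => unshift μ x) (fun μ => shift μ x) j)) + 1 * φ₂ x = φ₁ x) →
      ∀ x, φ₂ x ≤ C₃ * Real.sqrt (∑ y, (fun _ : TSite d (towerP L m (n + 1)) => c₀) y * ψ y ^ 2))
    (f : SiteL2K ℂ d (towerP L m (n + 1)) c₀ W) {F μ : ℝ} (hF : ∀ y, ‖WL2.equiv ℂ _ W f y‖ ≤ F) (hμ : ‖f‖ ≤ Real.sqrt μ * F)
    (x : TSite d (towerP L m (n + 1))) :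
    ‖WL2.equiv ℂ _ W (GpOfUk L m n φ η U a' hpos' f) x‖ ≤ (2 + (2 * p₂ + C₃) * CE * Real.sqrt μ) * F := by
  -- the solution and the penalty term `q = (Δ′_{a′}(U) − Δ^η_U)u = a′Q′†Q′u`
  set u : SiteL2K ℂ d (towerP L m (n + 1)) c₀ W := GpOfUk L m n φ η U a' hpos' f with hu_def
  set q : SiteL2K ℂ d (towerP L m (n + 1)) c₀ W := laplacePrimeAk L m n φ η U a' (c₁ := c₁) u -
    covLaplaceSiteK ((η : ℂ))⁻¹ (adTransportW φ U) (adTransportW φ fun b => (U b)⁻¹) u with hq_def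
  -- `Δ′_{a′}(U) u = f`, i.e. `Δ^η_U u = f − q`
  have hsol : laplacePrimeAk L m n φ η U a' (c₁ := c₁) u = f := by rw [hu_def]; exact apply_greenK hpos' f
  have hsplit : covLaplaceSiteK ((η : ℂ))⁻¹ (adTransportW φ U) (adTransportW φ fun b => (U b)⁻¹) u = f - q := by
    rw [hq_def, hsol]; abel
  -- the Kato form of (3.23) with the REAL difference quotient `t = η⁻¹`
  have hcast : ((η : ℂ))⁻¹ = (RCLike.ofReal (η⁻¹) : ℂ) := (Complex.ofReal_inv η).symm
  rw [hcast] at hsplit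
  -- abstract data of the bootstrap
  let nbr : TSite d (towerP L m (n + 1)) → Fin d ⊕ Fin d → TSite d (towerP L m (n + 1)) := fun y j => Sum.elim (fun μ => unshift μ y) (fun μ => shift μ y) j
  let T : TSite d (towerP L m (n + 1)) → Fin d ⊕ Fin d → W →ₗ[ℂ] W :=
    fun y j => Sum.elim (fun μ => adTransportW φ (fun b => (U b)⁻¹) (unshift μ y, μ)) (fun μ => adTransportW φ U (y, μ)) j
  have hT : ∀ y j v, ‖T y j v‖ ≤ ‖v‖ := fun y j v => by
    rcases j with μ | μ
    · exact hS _ v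
    · exact hR _ v
  have hu : ∀ y, ∑ j, (RCLike.ofReal ((η⁻¹) ^ 2) : ℂ) • (WL2.equiv ℂ _ W u y - T y j (WL2.equiv ℂ _ W u (nbr y j))) =
      WL2.equiv ℂ _ W f y - WL2.equiv ℂ _ W q y := by
    intro y
    have h := congr_arg (fun g => WL2.equiv ℂ _ W g y) hsplit
    simp only [WL2.equiv_sub, Pi.sub_apply] at h
    rw [equiv_covLaplaceSiteK_eq_sum (η⁻¹) _ _ (adTransportW_inv_adTransportW φ U) u y] at h
    rw [← h, Fintype.sum_sum_type, ← Finset.sum_add_distrib]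
    refine Finset.sum_congr rfl fun μ _ => ?_
    rw [← smul_add]; rfl
  -- the letters in the bootstrap's currency
  have hPq : ∀ y, ‖WL2.equiv ℂ _ W q y‖ ≤ p₂ * ‖u‖ := fun y => hP u y
  have hEn : Real.sqrt (∑ y, c₀ * ‖WL2.equiv ℂ _ W u y‖ ^ 2) ≤ CE * Real.sqrt (∑ y, c₀ * ‖WL2.equiv ℂ _ W f y‖ ^ 2) := by
    rw [← norm_eq_sqrt_sum_tower, ← norm_eq_sqrt_sum_tower, hu_def]; exact hE f
  have hPq₂ : p₂ * ‖u‖ ≤ p₂ * Real.sqrt (∑ y, c₀ * ‖WL2.equiv ℂ _ W u y‖ ^ 2) := by rw [← norm_eq_sqrt_sum_tower]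
  have hsupp : Real.sqrt (∑ y, c₀ * ‖WL2.equiv ℂ _ W f y‖ ^ 2) ≤ Real.sqrt μ * F := by rw [← norm_eq_sqrt_sum_tower]; exact hμ
  have h := norm_le_of_kato_bootstrap_energy (𝕜 := ℂ) nbr (fun _ _ => (η⁻¹) ^ 2) (fun _ _ => sq_nonneg _) T hT (fun _ => c₀) one_pos hC₃
    hFS hu hF hPq hp₂ hCE hEn hPq₂ hsupp x
  calc ‖WL2.equiv ℂ _ W u x‖ ≤ (2 / 1 + (2 * p₂ / 1 + 1 ^ 2 * C₃) * CE * Real.sqrt μ) * F := h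
    _ = (2 + (2 * p₂ + C₃) * CE * Real.sqrt μ) * F := by ring

/-- **THE VALUE ROW OF (3.42) FOR `G′_k(U)` ON THE CHAIN's CLASS, (T) INHABITED** (`[StarRing 𝔸]` for the unitarity letter): unitary `U`, `*`-trace, compatible fibre norm (the chain's standing letters
`hU`, `hτ₂`, `hφ`) in place of the contraction binders; the letters (P), (E), (FS), (supp) as in `norm_GpOfU_apply_le`.
[cite: Balaban1985BackgroundPropagators, Thm 3.1 (3.42) p.397, (3.24)–(3.25) p.394] -/
theorem norm_GpOfUk_apply_le_unitary [StarRing 𝔸] (τ : 𝔸 →ₗ[ℂ] ℂ) (hτ₂ : ∀ X Y : 𝔸, τ (X * Y) = τ (Y * X)) (hU : ∀ b, star (U b : 𝔸) = ((U b)⁻¹ : 𝔸ˣ))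
    (hφ : ∀ X Y : 𝔸, ⟪φ.symm X, φ.symm Y⟫_ℂ = τ (star X * Y))
    {p₂ CE C₃ : ℝ} (hp₂ : 0 ≤ p₂) (hCE : 0 ≤ CE) (hC₃ : 0 ≤ C₃)
    (hP : ∀ (v : SiteL2K ℂ d (towerP L m (n + 1)) c₀ W) (x : TSite d (towerP L m (n + 1))),
      ‖WL2.equiv ℂ _ W (laplacePrimeAk L m n φ η U a' (c₁ := c₁) v -
        covLaplaceSiteK ((η : ℂ))⁻¹ (adTransportW φ U) (adTransportW φ fun b => (U b)⁻¹) v) x‖ ≤ p₂ * ‖v‖)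
    (hE : ∀ g, ‖GpOfUk L m n φ η U a' hpos' g‖ ≤ CE * ‖g‖)
    (hFS : ∀ ψ φ₁ φ₂ : TSite d (towerP L m (n + 1)) → ℝ, (∀ x, 0 ≤ ψ x) →
      (∀ x, ∑ j : Fin d ⊕ Fin d, (η⁻¹) ^ 2 * (φ₁ x - φ₁ (Sum.elim (fun μ => unshift μ x) (fun μ => shift μ x) j)) + 1 * φ₁ x = ψ x) →
      (∀ x, ∑ j : Fin d ⊕ Fin d, (η⁻¹) ^ 2 * (φ₂ x - φ₂ (Sum.elim (fun μ => unshift μ x) (fun μ => shift μ x) j)) + 1 * φ₂ x = φ₁ x) →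
      ∀ x, φ₂ x ≤ C₃ * Real.sqrt (∑ y, (fun _ : TSite d (towerP L m (n + 1)) => c₀) y * ψ y ^ 2))
    (f : SiteL2K ℂ d (towerP L m (n + 1)) c₀ W) {F μ : ℝ} (hF : ∀ y, ‖WL2.equiv ℂ _ W f y‖ ≤ F) (hμ : ‖f‖ ≤ Real.sqrt μ * F)
    (x : TSite d (towerP L m (n + 1))) :
    ‖WL2.equiv ℂ _ W (GpOfUk L m n φ η U a' hpos' f) x‖ ≤ (2 + (2 * p₂ + C₃) * CE * Real.sqrt μ) * F :=
  norm_GpOfUk_apply_le L m n φ η U a' hpos' (fun b w => (norm_adTransportW_eq φ U τ hτ₂ hU hφ b w).le)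
    (fun b w => (norm_adTransportW_inv_eq φ U τ hτ₂ hU hφ b w).le) hp₂ hCE hC₃ hP hE hFS f hF hμ x

end Instance

end Literature.MathematicalPhysics.QuantumFieldTheory.Balaban1983to89.B9Eq342GreenPrimeTowerSupBound

end
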